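import Mathlib
import Literature.RingTheory.CohomologyAnnihilator.Basic
import Summits.ResolutionOfSingularities.ResolutionOfSingularities.Theorems.HomologicalConductorPersistenceKC3Dictionary
import Summits.ResolutionOfSingularities.ResolutionOfSingularities.Theorems.HomologicalConductorPersistenceKC3WitnessLocal
import Summits.ResolutionOfSingularities.ResolutionOfSingularities.Theorems.HomologicalConductorPersistenceKC3TowerInstance
import Summits.ResolutionOfSingularities.ResolutionOfSingularities.Theorems.HomologicalConductorPersistenceKC3FrobeniusOrderDefs
import HarnessLib

/-!
# Crux `Persistence` (stmt-ResolutionOfSingularities-16484), K-C3 §H2L object K5, part α: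
# `T₁ = loc O W` IS A LOCALISATION OF THE FROBENIUS ORDER `W₀ = k[a⁶, a⁴b, a³c, a²b², abc, c², b³]`

Route `ResolutionOfSingularities/HomologicalConductor`, chain W4.4b (CHAIN v13.5 §V13.13.1 row K5; holder of record
res-L1-w44b-lead-1). [OURS · L1 w44b] AI-written, weaker than expert review; NOT a statement of the manuscript under study
(Hironaka 2017) and no statement of it is used; no theorem here concludes the crux.

THE INSTANTIATION LAYER between the abstract K4 sockets and the route's literal tower stage. The K4 sockets of
res-D-pv-037 (`…FrobeniusOrderLocal.not_mem_cohomologyAnnihilator_of_frobeniusOrder_isLocalization`, K4d) and res-D-pv-058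
(`not_stablyAnnihilates_baseChange`, K4c socket form) speak of an ARBITRARY `kc3W k`-algebra `Λ'` with `IsLocalization S Λ'` for a
submonoid `S` whose elements have non-zero constant term. This file supplies that structure for
`Λ' = ↥(loc O W)`, `O = O_w` the `(6,5,4)`-monomial valuation ring, `W = k[x, z, t, z²/x, zt/x, t²/x, z³/x²] ⊆ k(x,z,t)`
(KC3 SPELLING v1.1), along res-D-pv-021's dictionary `e : W₀ ≃ₐ[k] W` (`…KC3Dictionary.exists_algEquiv_W₀_W`, values
`e(a⁶) = x, …`, with its field endomorphism `θ`, `θ ∘ e = ι`):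
* §1 `constantCoeff_eq_coeff_of_laurent` — for `w ∈ W₀` with `e w = g · x⁻ᵐ` (closed form of `W`, res-D-pv-021/084
  `mem_W_iff`): `w(0) = coeff_{x^m} g` (via `θ`, res-D-pv-058's `exists_dict_eq_mul`);
* §2 `inv_coe_mem_iff_constantCoeff_ne_zero` — **`(e w)⁻¹ ∈ O ↔ w(0) ≠ 0`** for `e w ≠ 0` (⇒: res-D-pv-058's denominator
  lemma `coeff_ne_zero_of_inv_mem`; ⇐: the `(6,5,4)`-value of `g` is `exp(−6m)`, attained at `x^m` alone);
* §3 the submonoid `S = (constantCoeff ∘ val)⁻¹(units) ⊆ W₀` (`mem_kc3S_iff : s ∈ S ↔ constantCoeff ↑s ≠ 0`, so 058's `hS` is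
  `Iff.mp`), and **`isLocalization_loc_W` : `IsLocalization S ↥(loc O W)`** for the algebra structure
  `W₀ →(e) W ↪ loc O W` (map_units by §2 ⇐, surjectivity by the closed form `mem_loc_iff` (res-D-pv-043) and §2 ⇒,
  injectivity inside the field);
* §0 `exists_kc3_dictionary` (res-D-pv-021's `σ` retyped at `kc3W k`, with `e(a⁶) = x`);
* §4 `isNoetherianRing_loc_W` (localisation of the noetherian `W₀`, res-D-pv-037 `kc3W.isNoetherianRing`);
* §5 the last inch `not_mem_ca_of_not_mem_cohomologyAnnihilator : ⟨x,_⟩ ∉ ca(↥(loc O W)) → x ∉ NoZeno.Birth.ca (loc O W)`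
  (`Subalgebra.image_coe_cohomologyAnnihilator`).
References: `ca` vocabulary [cite: IyengarTakahashi2014, Definition 2.1]; the rest is elementary localisation bookkeeping.
-/

noncomputable section

-- single-problem summit: the doubled namespace component `ResolutionOfSingularities` is forced
set_option linter.dupNamespace false

open MvPolynomial WithZero
open Literature.AlgebraicGeometry.Resolution.WeightedBlowup
open Literature.RingTheory.CohomologyAnnihilator
open Summit.ResolutionOfSingularities.ResolutionOfSingularities.Theorems.NoZeno.Birth
open Summit.ResolutionOfSingularities.ResolutionOfSingularities.Theorems.HomologicalConductor.PersistenceKC3ChartClosedForm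
open Summit.ResolutionOfSingularities.ResolutionOfSingularities.Theorems.HomologicalConductor.PersistenceMonomialValuation
open Summit.ResolutionOfSingularities.ResolutionOfSingularities.Theorems.HomologicalConductor.PersistenceKC3Tower
open Summit.ResolutionOfSingularities.ResolutionOfSingularities.Theorems.HomologicalConductor.KC3WitnessLocal
open Summit.ResolutionOfSingularities.ResolutionOfSingularities.Theorems.HomologicalConductor.KC3FrobeniusOrder

namespace Summit.ResolutionOfSingularities.ResolutionOfSingularities.Theorems.HomologicalConductor.PersistenceKC3Loc

variable {k : Type} [Field k]

/-- `K = k(x,z,t)` (local notation only). -/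
local notation3 "𝕂" => FractionRing (MvPolynomial (Fin 3) k)
/-- `ι : k[x,z,t] → K` (local notation only). -/
local notation3 "ι" => algebraMap (MvPolynomial (Fin 3) k) (FractionRing (MvPolynomial (Fin 3) k))
/-- `x`. -/
local notation3 "𝔵" => algebraMap (MvPolynomial (Fin 3) k) (FractionRing (MvPolynomial (Fin 3) k)) (MvPolynomial.X 0)
/-- `z`. -/
local notation3 "𝔷" => algebraMap (MvPolynomial (Fin 3) k) (FractionRing (MvPolynomial (Fin 3) k)) (MvPolynomial.X 1)
/-- `t`. -/
local notation3 "𝔱" => algebraMap (MvPolynomial (Fin 3) k) (FractionRing (MvPolynomial (Fin 3) k)) (MvPolynomial.X 2)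
/-- `W = k[x, z, t, z²x⁻¹, ztx⁻¹, t²x⁻¹, z³x⁻¹x⁻¹] ⊆ k(x,z,t)` (spelling of `kc3_tower_one_eq`; local notation only). -/
local notation3 "𝕎" => (Algebra.adjoin k
  ({algebraMap (MvPolynomial (Fin 3) k) (FractionRing (MvPolynomial (Fin 3) k)) (MvPolynomial.X 0),
    algebraMap (MvPolynomial (Fin 3) k) (FractionRing (MvPolynomial (Fin 3) k)) (MvPolynomial.X 1),
    algebraMap (MvPolynomial (Fin 3) k) (FractionRing (MvPolynomial (Fin 3) k)) (MvPolynomial.X 2),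
    algebraMap (MvPolynomial (Fin 3) k) (FractionRing (MvPolynomial (Fin 3) k)) (MvPolynomial.X 1) ^ 2 *
      (algebraMap (MvPolynomial (Fin 3) k) (FractionRing (MvPolynomial (Fin 3) k)) (MvPolynomial.X 0))⁻¹,
    algebraMap (MvPolynomial (Fin 3) k) (FractionRing (MvPolynomial (Fin 3) k)) (MvPolynomial.X 1) *
      algebraMap (MvPolynomial (Fin 3) k) (FractionRing (MvPolynomial (Fin 3) k)) (MvPolynomial.X 2) *
      (algebraMap (MvPolynomial (Fin 3) k) (FractionRing (MvPolynomial (Fin 3) k)) (MvPolynomial.X 0))⁻¹,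
    algebraMap (MvPolynomial (Fin 3) k) (FractionRing (MvPolynomial (Fin 3) k)) (MvPolynomial.X 2) ^ 2 *
      (algebraMap (MvPolynomial (Fin 3) k) (FractionRing (MvPolynomial (Fin 3) k)) (MvPolynomial.X 0))⁻¹,
    algebraMap (MvPolynomial (Fin 3) k) (FractionRing (MvPolynomial (Fin 3) k)) (MvPolynomial.X 1) ^ 3 *
      (algebraMap (MvPolynomial (Fin 3) k) (FractionRing (MvPolynomial (Fin 3) k)) (MvPolynomial.X 0))⁻¹ *
      (algebraMap (MvPolynomial (Fin 3) k) (FractionRing (MvPolynomial (Fin 3) k)) (MvPolynomial.X 0))⁻¹} :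
    Set (FractionRing (MvPolynomial (Fin 3) k))) : Subalgebra k (FractionRing (MvPolynomial (Fin 3) k)))
/-- The `(6,5,4)`-monomial valuation ring `O ⊆ K` (res-type-084's K3a; local notation only). -/
local notation3 "𝕆" => monomialValuationRing k (kc3Weight 1) (FractionRing (MvPolynomial (Fin 3) k))
/-- The dictionary substitution `θ₀ : a ↦ a⁶… no: x ↦ x⁶, z ↦ x⁴z, t ↦ x³t` on `k[X₀,X₁,X₂]` — res-D-pv-058's `dict`,
spelled as in res-D-pv-021's `exists_algEquiv_W₀_W` (local notation only). -/
local notation3 "θ₀" => MvPolynomial.aeval (R := k) (S₁ := MvPolynomial (Fin 3) k)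
  (![MvPolynomial.X 0 ^ 6, MvPolynomial.X 0 ^ 4 * MvPolynomial.X 1, MvPolynomial.X 0 ^ 3 * MvPolynomial.X 2] :
    Fin 3 → MvPolynomial (Fin 3) k)

/-! ## §0 `W ≤ loc O W`; `θ₀ = dict` -/

/-- `W ≤ loc O W`. [folklore] -/
theorem W_le_loc : 𝕎 ≤ loc 𝕆 𝕎 := fun _ hy => mem_loc_of_mem hy

/-- The dictionary substitution of res-D-pv-021 IS res-D-pv-058's `dict`. [OURS · bookkeeping] -/
theorem aeval_eq_dict : (θ₀ : MvPolynomial (Fin 3) k →ₐ[k] MvPolynomial (Fin 3) k) = dict := rfl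

/-- `a⁶ ∈ W₀`. [OURS · bookkeeping] -/
theorem X_pow_six_mem_kc3W : (X 0 ^ 6 : MvPolynomial (Fin 3) k) ∈ kc3W k :=
  Algebra.subset_adjoin (by simp)

/-- **res-D-pv-021's dictionary `σ`, retyped at res-D-pv-037's `kc3W k`** (the two generator sets are literally the same, so this
is `PersistenceKC3Dictionary.exists_algEquiv_W₀_W` up to unfolding `kc3W`): an isomorphism `e : W₀ ≃ₐ[k] W` with `e(a⁶) = x`,
together with a field endomorphism `θ` of `K` extending the substitution `θ₀` and satisfying `θ ∘ e = ι`. [OURS · L1 w44b · K-C3 σ] -/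
theorem exists_kc3_dictionary : ∃ (e : ↥(kc3W k) ≃ₐ[k] ↥𝕎) (θ : 𝕂 →ₐ[k] 𝕂),
    (∀ p : MvPolynomial (Fin 3) k, θ (ι p) = ι (θ₀ p)) ∧
    (∀ w : ↥(kc3W k), θ (e w : 𝕂) = ι (w : MvPolynomial (Fin 3) k)) ∧
    ((e ⟨X 0 ^ 6, X_pow_six_mem_kc3W⟩ : 𝕂) = 𝔵) := by
  obtain ⟨e, h1, -, -, -, -, -, -, θ, hθι, hθe⟩ := PersistenceKC3Dictionary.exists_algEquiv_W₀_W (k := k)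
  exact ⟨e, θ, hθι, fun w => hθe w, h1 _⟩

/-! ## §1 Constant terms through the dictionary -/

/-- For `w ∈ W₀` with `e w = g · x⁻ᵐ` (`6m ≤ ν_{(6,4,3)}(g)`): the constant term of `w` is the coefficient of `x^m` in
`g`. (`ι w = θ (e w) = θ(ι g) · (θ x)⁻ᵐ = ι(dict g) · x^{-6m} = ι q`, `dict g = x^{6m} q`, `q(0) = coeff_{x^m} g`.)
[OURS · L1 w44b · K-C3 K5α] -/
theorem constantCoeff_eq_coeff_of_laurent (e : ↥(kc3W k) ≃ₐ[k] ↥𝕎) (θ : 𝕂 →ₐ[k] 𝕂)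
    (hθι : ∀ p : MvPolynomial (Fin 3) k, θ (ι p) = ι (θ₀ p))
    (hθe : ∀ w : ↥(kc3W k), θ (e w : 𝕂) = ι (w : MvPolynomial (Fin 3) k))
    (w : ↥(kc3W k)) (g : MvPolynomial (Fin 3) k) (m : ℕ)
    (hw : ((6 * m : ℕ) : ℕ∞) ≤ monomialOrd (![6, 4, 3] : Fin 3 → ℕ) g) (hew : (e w : 𝕂) = ι g * 𝔵⁻¹ ^ m) :
    constantCoeff (w : MvPolynomial (Fin 3) k) = coeff (Finsupp.single 0 m) g := by
  obtain ⟨q, hq, hq0⟩ := exists_dict_eq_mul g m hw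
  have hx0 : (𝔵 : 𝕂) ≠ 0 := x_ne_zero
  have hθx : θ 𝔵 = 𝔵 ^ 6 := by rw [hθι, aeval_X]; simp
  have hx6 : (𝔵 : 𝕂) ^ (6 * m) * ((𝔵 ^ 6)⁻¹) ^ m = 1 := by
    rw [← inv_pow, ← pow_mul, ← mul_pow, mul_inv_cancel₀ hx0, one_pow]
  have h1 : ι (w : MvPolynomial (Fin 3) k) = ι q := by
    rw [← hθe w, hew, map_mul, map_pow, map_inv₀, hθι, aeval_eq_dict, hq, hθx, map_mul, map_pow]
    calc 𝔵 ^ (6 * m) * ι q * ((𝔵 ^ 6)⁻¹) ^ m = (𝔵 ^ (6 * m) * ((𝔵 ^ 6)⁻¹) ^ m) * ι q := by ring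
      _ = ι q := by rw [hx6, one_mul]
  have h2 : (w : MvPolynomial (Fin 3) k) = q := algebraMap_injective h1
  rw [h2, ← hq0, constantCoeff_eq]

/-! ## §2 Units of `O` among the images of `W₀` -/

/-- `⇒`: if `e w ≠ 0` and `(e w)⁻¹ ∈ O` then `w(0) ≠ 0` (res-D-pv-058's denominator lemma through §1).
[OURS · L1 w44b · K-C3 K5α] -/
theorem constantCoeff_ne_zero_of_inv_mem (e : ↥(kc3W k) ≃ₐ[k] ↥𝕎) (θ : 𝕂 →ₐ[k] 𝕂)
    (hθι : ∀ p : MvPolynomial (Fin 3) k, θ (ι p) = ι (θ₀ p))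
    (hθe : ∀ w : ↥(kc3W k), θ (e w : 𝕂) = ι (w : MvPolynomial (Fin 3) k))
    (w : ↥(kc3W k)) (hne : (e w : 𝕂) ≠ 0) (hO : ((e w : 𝕂))⁻¹ ∈ 𝕆) :
    constantCoeff (w : MvPolynomial (Fin 3) k) ≠ 0 := by
  obtain ⟨g, m, hwm, hew⟩ := (mem_W_iff (e w : 𝕂)).mp (e w).2
  have hg : g ≠ 0 := by
    rintro rfl
    exact hne (by rw [hew, map_zero, zero_mul])
  rw [constantCoeff_eq_coeff_of_laurent e θ hθι hθe w g m hwm hew]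
  rw [hew] at hO
  exact coeff_ne_zero_of_inv_mem g m hwm hg hO

/-- `⇐`: if `w(0) ≠ 0` then `e w ≠ 0` and `(e w)⁻¹ ∈ O`: with `e w = g · x⁻ᵐ`, `coeff_{x^m} g = w(0) ≠ 0`, every monomial
of `g` has `(6,5,4)`-weight `≥` its `(6,4,3)`-weight `≥ 6m`, and `x^m` has weight `6m`, so `v(g) = exp(−6m)` and
`v(g · x⁻ᵐ) = 1`. [OURS · L1 w44b · K-C3 K5α] -/
theorem inv_mem_of_constantCoeff_ne_zero (e : ↥(kc3W k) ≃ₐ[k] ↥𝕎) (θ : 𝕂 →ₐ[k] 𝕂)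
    (hθι : ∀ p : MvPolynomial (Fin 3) k, θ (ι p) = ι (θ₀ p))
    (hθe : ∀ w : ↥(kc3W k), θ (e w : 𝕂) = ι (w : MvPolynomial (Fin 3) k))
    (w : ↥(kc3W k)) (hw : constantCoeff (w : MvPolynomial (Fin 3) k) ≠ 0) :
    (e w : 𝕂) ≠ 0 ∧ ((e w : 𝕂))⁻¹ ∈ 𝕆 := by
  obtain ⟨g, m, hwm, hew⟩ := (mem_W_iff (e w : 𝕂)).mp (e w).2
  have hc : coeff (Finsupp.single 0 m) g ≠ 0 := by
    rwa [← constantCoeff_eq_coeff_of_laurent e θ hθι hθe w g m hwm hew]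
  have hsupp : Finsupp.single (0 : Fin 3) m ∈ g.support := mem_support_iff.mpr hc
  have hg : g ≠ 0 := ne_zero_iff.mpr ⟨_, hc⟩
  -- the `(6,5,4)`-valuation of `g` is `exp(−6m)`
  have hmin : ∀ d' ∈ g.support, Finsupp.weight (kc3Weight 1) (Finsupp.single (0 : Fin 3) m) ≤
      Finsupp.weight (kc3Weight 1) d' := by
    intro d' hd'
    have h643 := (le_monomialOrd_iff_weight g (6 * m)).mp hwm d' hd'
    rw [weight_kc3_eq, weight_kc3_eq]
    simp only [Finsupp.single_eq_same, Finsupp.single_eq_of_ne (show (1 : Fin 3) ≠ 0 by decide),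
      Finsupp.single_eq_of_ne (show (2 : Fin 3) ≠ 0 by decide), mul_zero, add_zero]
    omega
  have hval : monomialValuation k (kc3Weight 1) g = exp (-((6 * m : ℕ) : ℤ)) := by
    rw [monomialValuation_eq_exp_neg_weight k (kc3Weight 1) hsupp hmin, weight_kc3_eq]
    simp
  have hvx : monomialValuationFrac k (kc3Weight 1) 𝕂 (ι g * 𝔵⁻¹ ^ m) = 1 := by
    rw [map_mul, map_pow, map_inv₀, monomialValuationFrac_algebraMap, monomialValuationFrac_X, hval,
      kc3Weight_zero, ← exp_neg, ← exp_nsmul, ← exp_add, ← exp_zero]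
    congr 1
    simp only [nsmul_eq_mul]
    push_cast
    ring
  have hne : (ι g * 𝔵⁻¹ ^ m : 𝕂) ≠ 0 :=
    mul_ne_zero (fun h => hg (algebraMap_injective (h.trans (map_zero _).symm)))
      (pow_ne_zero _ (inv_ne_zero x_ne_zero))
  refine ⟨by rw [hew]; exact hne, ?_⟩
  rw [hew, mem_monomialValuationRing_iff, map_inv₀, hvx, inv_one]

/-! ## §3 The submonoid `S ⊆ W₀` of elements with non-zero constant term; `loc O W` is `W₀[S⁻¹]` -/

/-- `s ∈ S := (constantCoeff ∘ val)⁻¹(kˣ) ↔ s(0) ≠ 0`. [OURS · bookkeeping] -/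
theorem mem_kc3S_iff (s : ↥(kc3W k)) :
    s ∈ (IsUnit.submonoid k).comap (((MvPolynomial.constantCoeff : MvPolynomial (Fin 3) k →+* k).comp
      (Subalgebra.val (kc3W k)).toRingHom).toMonoidHom) ↔ constantCoeff (s : MvPolynomial (Fin 3) k) ≠ 0 := by
  rw [Submonoid.mem_comap, IsUnit.mem_submonoid_iff, isUnit_iff_ne_zero]
  rfl

/-- res-D-pv-058's hypothesis `hS` for this `S`: every `s ∈ S` has `coeff 0 s ≠ 0`. [OURS · bookkeeping] -/
theorem coeff_zero_ne_zero_of_mem_kc3S (s : ↥(kc3W k))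
    (hs : s ∈ (IsUnit.submonoid k).comap (((MvPolynomial.constantCoeff : MvPolynomial (Fin 3) k →+* k).comp
      (Subalgebra.val (kc3W k)).toRingHom).toMonoidHom)) : coeff 0 (s : MvPolynomial (Fin 3) k) ≠ 0 := by
  rw [← constantCoeff_eq]; exact (mem_kc3S_iff s).mp hs

/-- **Generic localisation lemma for `loc`.** For ANY subalgebra `W ⊆ K`, valuation ring `O`, and ring `R₀` identified
with `W` by `e : R₀ ≃ₐ[k] ↥W`: if a submonoid `S ⊆ R₀` consists exactly of the `s` with `e s ≠ 0`, `(e s)⁻¹ ∈ O`, then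
`loc O W` is the localisation `R₀[S⁻¹]` along `R₀ →(e) W ↪ loc O W` (closed form `mem_loc_iff`, res-D-pv-043). Stated
generically so that the instance bookkeeping runs on small terms. [folklore] -/
theorem isLocalization_loc_of_algEquiv {K' : Type} [Field K'] [Algebra k K'] (O : ValuationSubring K')
    (W : Subalgebra k K') {R₀ : Type} [CommRing R₀] [Algebra k R₀] (e : R₀ ≃ₐ[k] ↥W) (S : Submonoid R₀)
    (hWloc : W ≤ loc O W) (hS : ∀ s : R₀, s ∈ S ↔ ((e s : K') ≠ 0 ∧ ((e s : K'))⁻¹ ∈ O)) :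
    letI := ((Subalgebra.inclusion hWloc).toRingHom.comp e.toAlgHom.toRingHom).toAlgebra
    IsLocalization S ↥(loc O W) := by
  letI := ((Subalgebra.inclusion hWloc).toRingHom.comp e.toAlgHom.toRingHom).toAlgebra
  have hamap : ∀ w : R₀, ((algebraMap R₀ ↥(loc O W) w : ↥(loc O W)) : K') = (e w : K') := fun w => rfl
  refine ⟨?_, ?_, ?_⟩
  · -- map_units
    rintro ⟨s, hs⟩
    obtain ⟨hne, hO⟩ := (hS s).mp hs
    have hinv : ((e s : K'))⁻¹ ∈ loc O W := PersistenceKC3TowerInstance.inv_mem_loc O W (hWloc (e s).2) hO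
    refine isUnit_iff_exists_inv.mpr ⟨⟨_, hinv⟩, Subtype.ext ?_⟩
    rw [MulMemClass.coe_mul, OneMemClass.coe_one, hamap]
    exact mul_inv_cancel₀ hne
  · -- surj
    intro y
    obtain ⟨a, ha, s, hs, hsO, hy⟩ := (mem_loc_iff O W).mp y.2
    by_cases hs0 : s = 0
    · refine ⟨⟨0, 1⟩, Subtype.ext ?_⟩
      rw [MulMemClass.coe_mul, hamap, hamap, OneMemClass.coe_one, map_one, map_zero, OneMemClass.coe_one,
        ZeroMemClass.coe_zero, hy, hs0, inv_zero, mul_zero, zero_mul]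
    obtain ⟨a₀, ha₀⟩ : ∃ a₀ : R₀, (e a₀ : K') = a := ⟨e.symm ⟨a, ha⟩, by rw [AlgEquiv.apply_symm_apply]⟩
    obtain ⟨s₀, hs₀⟩ : ∃ s₀ : R₀, (e s₀ : K') = s := ⟨e.symm ⟨s, hs⟩, by rw [AlgEquiv.apply_symm_apply]⟩
    have hs₀S : s₀ ∈ S := (hS s₀).mpr ⟨by rw [hs₀]; exact hs0, by rw [hs₀]; exact hsO⟩
    refine ⟨⟨a₀, ⟨s₀, hs₀S⟩⟩, Subtype.ext ?_⟩
    rw [MulMemClass.coe_mul, hamap, hamap, hs₀, ha₀, hy, mul_assoc, inv_mul_cancel₀ hs0, mul_one]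
  · -- exists_of_eq
    intro a b hab
    refine ⟨1, ?_⟩
    have : (e a : K') = (e b : K') := by rw [← hamap, ← hamap, hab]
    rw [OneMemClass.coe_one, one_mul, one_mul]
    exact e.injective (Subtype.ext this)

/-- The membership test of the generic lemma at the K-C3 datum: `s ∈ S ↔ e s ≠ 0 ∧ (e s)⁻¹ ∈ O` (§2).
[OURS · L1 w44b · K-C3 K5α] -/
theorem mem_kc3S_iff_unit (e : ↥(kc3W k) ≃ₐ[k] ↥𝕎) (θ : 𝕂 →ₐ[k] 𝕂)
    (hθι : ∀ p : MvPolynomial (Fin 3) k, θ (ι p) = ι (θ₀ p))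
    (hθe : ∀ w : ↥(kc3W k), θ (e w : 𝕂) = ι (w : MvPolynomial (Fin 3) k)) (s : ↥(kc3W k)) :
    s ∈ (IsUnit.submonoid k).comap (((MvPolynomial.constantCoeff : MvPolynomial (Fin 3) k →+* k).comp
      (Subalgebra.val (kc3W k)).toRingHom).toMonoidHom) ↔ ((e s : 𝕂) ≠ 0 ∧ ((e s : 𝕂))⁻¹ ∈ 𝕆) := by
  rw [mem_kc3S_iff]
  exact ⟨inv_mem_of_constantCoeff_ne_zero e θ hθι hθe s,
    fun h => constantCoeff_ne_zero_of_inv_mem e θ hθι hθe s h.1 h.2⟩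

/-- **`loc O W` is the localisation of `W₀` at `S`** along `W₀ →(e) W ↪ loc O W`. [OURS · L1 w44b · K-C3 K5α] -/
theorem isLocalization_loc_W (e : ↥(kc3W k) ≃ₐ[k] ↥𝕎) (θ : 𝕂 →ₐ[k] 𝕂)
    (hθι : ∀ p : MvPolynomial (Fin 3) k, θ (ι p) = ι (θ₀ p))
    (hθe : ∀ w : ↥(kc3W k), θ (e w : 𝕂) = ι (w : MvPolynomial (Fin 3) k)) :
    letI := ((Subalgebra.inclusion (W_le_loc (k := k))).toRingHom.comp e.toAlgHom.toRingHom).toAlgebra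
    IsLocalization ((IsUnit.submonoid k).comap (((MvPolynomial.constantCoeff : MvPolynomial (Fin 3) k →+* k).comp
      (Subalgebra.val (kc3W k)).toRingHom).toMonoidHom)) ↥(loc 𝕆 𝕎) :=
  isLocalization_loc_of_algEquiv 𝕆 𝕎 e _ W_le_loc (mem_kc3S_iff_unit e θ hθι hθe)

/-! ## §4 Noetherianity of `T₁`; the value of `a⁶` -/

/-- **`loc O W` is a noetherian ring** (a localisation of the finitely generated `k`-algebra `W₀`). [folklore] -/
theorem isNoetherianRing_loc_W : IsNoetherianRing ↥(loc 𝕆 𝕎) := by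
  obtain ⟨e, θ, hθι, hθe, -⟩ := exists_kc3_dictionary (k := k)
  letI := ((Subalgebra.inclusion (W_le_loc (k := k))).toRingHom.comp e.toAlgHom.toRingHom).toAlgebra
  haveI := isLocalization_loc_W e θ hθι hθe
  exact IsLocalization.isNoetherianRing ((IsUnit.submonoid k).comap (((MvPolynomial.constantCoeff :
    MvPolynomial (Fin 3) k →+* k).comp (Subalgebra.val (kc3W k)).toRingHom).toMonoidHom)) _ inferInstance

/-! ## §5 The last inch: from the Literature ideal to the route's `ca` -/

/-- For a subalgebra `B ⊆ K` and `x ∈ B`: `x ∈ ca B ↔ ⟨x, hx⟩ ∈ cohomologyAnnihilator ↥B`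
(`Subalgebra.image_coe_cohomologyAnnihilator`). [cite: IyengarTakahashi2014, Definition 2.1] -/
theorem mem_ca_iff_mem_cohomologyAnnihilator {K' : Type} [Field K'] [Algebra k K'] (B : Subalgebra k K') {x : K'}
    (hx : x ∈ B) : x ∈ NoZeno.Birth.ca B ↔ (⟨x, hx⟩ : ↥B) ∈ cohomologyAnnihilator ↥B := by
  have h : NoZeno.Birth.ca B = ((↑) : ↥B → K') '' (cohomologyAnnihilator ↥B : Set ↥B) :=
    (Subalgebra.image_coe_cohomologyAnnihilator B).symm
  rw [h]
  constructor
  · rintro ⟨y, hy, hyx⟩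
    have : y = ⟨x, hx⟩ := Subtype.ext hyx
    rwa [this] at hy
  · intro h'
    exact ⟨_, h', rfl⟩

/-- **The last inch of socket K4**: if `⟨x, _⟩ ∉ cohomologyAnnihilator ↥(loc O W)` then `x ∉ ca (loc O W)`.
[cite: IyengarTakahashi2014, Definition 2.1] -/
theorem not_mem_ca_of_not_mem_cohomologyAnnihilator {K' : Type} [Field K'] [Algebra k K'] (B : Subalgebra k K')
    {x : K'} (hx : x ∈ B) (h : (⟨x, hx⟩ : ↥B) ∉ cohomologyAnnihilator ↥B) : x ∉ NoZeno.Birth.ca B :=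
  fun h' => h ((mem_ca_iff_mem_cohomologyAnnihilator B hx).mp h')

end Summit.ResolutionOfSingularities.ResolutionOfSingularities.Theorems.HomologicalConductor.PersistenceKC3Loc

end
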